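import Mathlib
import Literature.Analysis.FluidPDE.SuitableWeak
import Literature.Analysis.FluidPDE.SuitableWeakRightContinuity
import Literature.Analysis.FluidPDE.LeraySeparationOfEnergyTools
import Literature.Analysis.FunctionSpaces.Mollification
import HarnessLib

/-!
# BC5 rung B of the crux `EulerZoomLiouville.PowerGaugeEulerLiouville` (steady members) — tools

§B candidate of record `EulerZoomLiouville` (NavierStokesRegularity, residual `NoTypeII` =
stmt-NavierStokesRegularity-0056), attacked conjunct
`E = PowerGaugeEulerLiouville`: an ancient local-energy Euler flow on `ℝ³ × (−∞, 0)` whose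
power-gauged CKN quantities at the origin satisfy Seregin's bound
`sup_{a > 0} (a^{2ρ} A(a) + a^{ρ} E(a) + a^{2ρ} D(a)) ≤ c` vanishes.  This file proves the rung
INSIDE the open window `0 < ρ ≤ 1/2` on the STEADY stratum (the planners' plan-only
`bc/PowerGaugeEulerLiouville_rungB_plan.lean`, typed verbatim as `powerGaugeEulerLiouville_steady`):
a time-independent member `u(t, x) = U(x)` of the class is zero, for every `ρ > 0` (indeed the
argument only uses `ρ > −1`).

Proof.  (1) The `E`-gauge gives `∫∫_{Q_a} |H|²_F ≤ c a^{1−ρ}` for the space–time weak gradient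
`H`; averaging the defining identity of `H` against a normalised time bump of height `≤ 2/a²`
supported in `(−a², 0)` shows that every spatial pairing `∫ ∂_v ψ ⟪U, w⟫` is bounded by
`O(a^{−(1+ρ)/2}) → 0`, so `U` has the ZERO weak derivative on `ℝ³`
(`integral_fderiv_mul_inner_eq_zero_of_steady`, `hasWeakFDerivOn_zero_of_steady`).
(2) A function with zero weak derivative on the whole space is a.e. constant — mollifications
have zero derivative, hence are constant, and converge a.e. (`ae_eq_const_of_hasWeakFDerivOn_zero`,
via the tree's `Literature.Analysis.FunctionSpaces.HasWeakFDerivOn.hasFDerivAt_convolution`).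
(3) The `A`-gauge `a^{2ρ} · a⁻¹ · ‖b‖² |B_a| ≤ c` kills the constant (`const_eq_zero_of_gaugeA`).
The Euler system and the local energy inequality are NOT used: on the steady stratum the gauges
decide by themselves (critic-2's K-READ 01: rung B is "large-scale arithmetic").
WHAT THIS IS NOT: not NS regularity, not `NoTypeII`; a kernel-checked rung of the §B conjunct `E`.
-/

noncomputable section

set_option linter.dupNamespace false

open MeasureTheory Set Filter Topology Metric Function TopologicalSpace
open scoped ENNReal NNReal Convolution InnerProductSpace RealInnerProductSpace ContDiff

namespace Summit.NavierStokesRegularity.NavierStokesRegularity.Theorems.PowerGaugeEulerLiouville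

open Literature.Analysis Literature.Analysis.FunctionSpaces Literature.Analysis.FluidPDE

/-! ## (2) Zero weak derivative on the whole space ⇒ a.e. constant -/

section Const

variable {E : Type*} [NormedAddCommGroup E] [InnerProductSpace ℝ E] [FiniteDimensional ℝ E]
  [MeasurableSpace E] [BorelSpace E]
variable {F : Type*} [NormedAddCommGroup F] [NormedSpace ℝ F] [CompleteSpace F]

/-- **A locally integrable function with zero weak derivative on the whole space is a.e.
constant** (Evans, *PDE*, §5.2.1 / App. C.4: the mollifications `η_ε ⋆ f` have derivative
`η_ε ⋆ Df = 0`, hence are constant, and converge to `f` a.e.). [folklore] -/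
theorem ae_eq_const_of_hasWeakFDerivOn_zero {f : E → F}
    (hw : HasWeakFDerivOn (⊤ : Opens E) volume f 0) :
    ∃ c : F, f =ᵐ[volume] fun _ => c := by
  obtain ⟨φ, hφ, h'φ⟩ := exists_contDiffBump_seq (E := E)
  have hf : LocallyIntegrable f volume := locallyIntegrableOn_univ.1 (by
    simpa only [Opens.coe_top] using hw.locallyIntegrableOn)
  -- each mollification has zero derivative everywhere, hence is constant
  have hconst : ∀ n (x y : E),
      ((φ n).normed volume ⋆[ContinuousLinearMap.lsmul ℝ ℝ, volume] f) x =
        ((φ n).normed volume ⋆[ContinuousLinearMap.lsmul ℝ ℝ, volume] f) y := by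
    intro n
    have hD : ∀ x, HasFDerivAt ((φ n).normed volume ⋆[ContinuousLinearMap.lsmul ℝ ℝ, volume] f)
        (0 : E →L[ℝ] F) x := by
      intro x
      have h := hw.hasFDerivAt_convolution (isTestFunctionOn_normed (φ n)) x
      rwa [convolution_zero, Pi.zero_apply] at h
    exact is_const_of_fderiv_eq_zero (fun x => (hD x).differentiableAt) (fun x => (hD x).fderiv)
  have hae := ae_tendsto_normed_convolution hφ h'φ hf
  haveI : (ae (volume : Measure E)).NeBot := ae_neBot.2 (NeZero.ne _)
  obtain ⟨x₀, hx₀⟩ := hae.exists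
  refine ⟨f x₀, ?_⟩
  filter_upwards [hae] with x hx
  have h1 : Tendsto (fun n => ((φ n).normed volume ⋆[ContinuousLinearMap.lsmul ℝ ℝ, volume] f) x)
      atTop (𝓝 (f x₀)) := by
    have heq : (fun n => ((φ n).normed volume ⋆[ContinuousLinearMap.lsmul ℝ ℝ, volume] f) x) =
        fun n => ((φ n).normed volume ⋆[ContinuousLinearMap.lsmul ℝ ℝ, volume] f) x₀ :=
      funext fun n => hconst n x x₀
    rw [heq]; exact hx₀
  exact tendsto_nhds_unique hx h1

end Const


/-! ## (1) Steady fields: from the space–time weak gradient to a zero spatial weak derivative -/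

section Steady

/-- A steady field whose time-independent extension is locally integrable on the slab
`(−∞, 0) × ℝ³` is locally integrable on `ℝ³` (Fubini on `[−2, −1] × K`). [folklore] -/
theorem locallyIntegrable_of_steady {U : EuclideanSpace ℝ (Fin 3) → EuclideanSpace ℝ (Fin 3)}
    (hU : LocallyIntegrableOn (uncurry fun _ : ℝ => U)
      ((slab (EuclideanSpace ℝ (Fin 3)) (Iio 0) isOpen_Iio : Opens (ℝ × EuclideanSpace ℝ (Fin 3))) :
        Set (ℝ × EuclideanSpace ℝ (Fin 3))) volume) :
    LocallyIntegrable U volume := by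
  refine locallyIntegrable_iff.2 fun K hK => ?_
  have hK' : IsCompact (Icc (-2 : ℝ) (-1) ×ˢ K) := isCompact_Icc.prod hK
  have hsub : Icc (-2 : ℝ) (-1) ×ˢ K ⊆
      ((slab (EuclideanSpace ℝ (Fin 3)) (Iio 0) isOpen_Iio : Opens (ℝ × EuclideanSpace ℝ (Fin 3))) :
        Set (ℝ × EuclideanSpace ℝ (Fin 3))) := by
    rintro ⟨t, x⟩ ⟨ht, -⟩
    rw [SetLike.mem_coe, mem_slab]
    exact lt_of_le_of_lt ht.2 (by norm_num)
  have hint : IntegrableOn (uncurry fun _ : ℝ => U) (Icc (-2 : ℝ) (-1) ×ˢ K) volume :=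
    hU.integrableOn_compact_subset hsub hK'
  rw [IntegrableOn, Measure.volume_eq_prod, ← Measure.prod_restrict] at hint
  have h1 := ((integrable_prod_iff hint.aestronglyMeasurable).1 hint).1
  haveI : (ae ((volume : Measure ℝ).restrict (Icc (-2 : ℝ) (-1)))).NeBot := by
    rw [ae_neBot, Ne, Measure.restrict_eq_zero, Real.volume_Icc]
    norm_num
  obtain ⟨t, ht⟩ := h1.exists
  exact ht

/-- **The averaging step.**  Let `U` be a steady field with space–time weak gradient `H` on the
slab `(−∞,0) × ℝ³`, and suppose that on the cylinders `(−a², 0) × B_R` the `L¹` mass of `H` is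
`o(a²)` along some `a → ∞` (for every `R`, `ε`).  Then every spatial pairing
`∫ ∂_v ψ ⟪U, w⟫` against a test function `ψ` vanishes: test the defining identity of `H` with
`χ_a(t) ψ(x)`, `χ_a` a normalised time bump of height `≤ 2/a²` supported in `(−a², 0)`. [folklore] -/
theorem integral_fderiv_mul_inner_eq_zero_of_steady
    {U : EuclideanSpace ℝ (Fin 3) → EuclideanSpace ℝ (Fin 3)}
    {H : ℝ → EuclideanSpace ℝ (Fin 3) → EuclideanSpace ℝ (Fin 3) →L[ℝ] EuclideanSpace ℝ (Fin 3)}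
    (hH : HasWeakSpatialGradientOn (slab (EuclideanSpace ℝ (Fin 3)) (Iio 0) isOpen_Iio)
      (fun _ : ℝ => U) H)
    (hsmall : ∀ R : ℝ, 0 < R → ∀ ε : ℝ, 0 < ε → ∃ a : ℝ, R < a ∧
      ∫⁻ q in Ioo (-(a ^ 2)) 0 ×ˢ ball (0 : EuclideanSpace ℝ (Fin 3)) R, ‖H q.1 q.2‖ₑ ≤
        ENNReal.ofReal ε * ENNReal.ofReal (a ^ 2))
    {ψ : EuclideanSpace ℝ (Fin 3) → ℝ} (hψ : IsTestFunctionOn (⊤ : Opens (EuclideanSpace ℝ (Fin 3))) ψ)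
    (v w : EuclideanSpace ℝ (Fin 3)) :
    ∫ x, fderiv ℝ ψ x v * ⟪U x, w⟫ = 0 := by
  set I : ℝ := ∫ x, fderiv ℝ ψ x v * ⟪U x, w⟫ with hI
  -- a bound on `|ψ|` and a ball containing its support
  obtain ⟨M, hM⟩ : ∃ M : ℝ, ∀ x, ‖ψ x‖ ≤ M :=
    hψ.hasCompactSupport.exists_bound_of_continuous hψ.contDiff.continuous
  have hM0 : 0 ≤ M := le_trans (norm_nonneg _) (hM 0)
  obtain ⟨R, hR0, hR⟩ : ∃ R : ℝ, 0 < R ∧ tsupport ψ ⊆ ball (0 : EuclideanSpace ℝ (Fin 3)) R :=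
    hψ.hasCompactSupport.isCompact.isBounded.subset_ball_lt 0 0
  -- the measurability of `‖H‖ₑ` restricted to subsets of the slab
  have hHmeas : AEStronglyMeasurable (uncurry H)
      (volume.restrict (Iio (0 : ℝ) ×ˢ (univ : Set (EuclideanSpace ℝ (Fin 3))))) := by
    have := hH.locallyIntegrableOn_grad.aestronglyMeasurable
    simpa [slab] using this
  -- main estimate: `|I| ≤ 2 M ‖v‖ ‖w‖ ε` for every `ε > 0`
  set K : ℝ := 2 * M * ‖v‖ * ‖w‖ with hK
  have hK0 : 0 ≤ K := by positivity
  have key : ∀ ε : ℝ, 0 < ε → |I| ≤ K * ε := by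
    intro ε hε
    obtain ⟨a, hRa, ha⟩ := hsmall R hR0 ε hε
    have ha0 : 0 < a := hR0.trans hRa
    have ha2 : 0 < a ^ 2 := by positivity
    -- the time bump
    let β : ContDiffBump (-(a ^ 2) / 2 : ℝ) := ⟨a ^ 2 / 4, a ^ 2 / 3, by positivity, by nlinarith⟩
    set χ : ℝ → ℝ := β.normed volume with hχ
    have hχ_smooth : ContDiff ℝ ∞ χ := β.contDiff_normed
    have hχ_nonneg : ∀ t, 0 ≤ χ t := β.nonneg_normed
    have hχ_int : ∫ t, χ t = 1 := β.integral_normed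
    have hχ_le : ∀ t, χ t ≤ 2 / a ^ 2 := by
      intro t
      have h1 := β.normed_le_div_measure_closedBall_rIn (μ := volume) t
      have h2 : (volume : Measure ℝ).real (closedBall (-(a ^ 2) / 2) β.rIn) = a ^ 2 / 2 := by
        rw [Measure.real, Real.volume_closedBall, ENNReal.toReal_ofReal (by positivity)]
        show 2 * (a ^ 2 / 4) = a ^ 2 / 2
        ring
      rw [h2] at h1
      calc χ t ≤ 1 / (a ^ 2 / 2) := h1
        _ = 2 / a ^ 2 := by field_simp
    have hχ_supp : ∀ t, χ t ≠ 0 → t ∈ Ioo (-(a ^ 2)) 0 := by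
      intro t ht
      have h1 : t ∈ Function.support χ := ht
      rw [hχ, β.support_normed_eq, Real.ball_eq_Ioo] at h1
      change t ∈ Ioo (-(a ^ 2) / 2 - a ^ 2 / 3) (-(a ^ 2) / 2 + a ^ 2 / 3) at h1
      exact ⟨by linarith [h1.1], by linarith [h1.2]⟩
    have hχ_zero : ∀ t, t ∉ Icc (-(5 * a ^ 2 / 6)) (-(a ^ 2 / 6)) → χ t = 0 := by
      intro t ht
      by_contra hne
      have h1 : t ∈ Function.support χ := hne
      rw [hχ, β.support_normed_eq, Real.ball_eq_Ioo] at h1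
      change t ∈ Ioo (-(a ^ 2) / 2 - a ^ 2 / 3) (-(a ^ 2) / 2 + a ^ 2 / 3) at h1
      exact ht ⟨by linarith [h1.1], by linarith [h1.2]⟩
    -- the space–time test function `χ(t) ψ(x)`
    have hφ : IsSpaceTimeTestOn (slab (EuclideanSpace ℝ (Fin 3)) (Iio 0) isOpen_Iio)
        (fun t x => χ t * ψ x) := by
      refine SuitableRestart.isSpaceTimeTestOn_mul (a := -(a ^ 2)) (b := 0) ?_ hχ_smooth
        (a₁ := -(5 * a ^ 2 / 6)) (b₁ := -(a ^ 2 / 6)) ?_ hχ_zero hψ.contDiff hψ.hasCompactSupport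
      · rintro ⟨t, x⟩ ⟨ht, -⟩
        rw [SetLike.mem_coe, mem_slab]
        exact ht.2
      · intro t ht
        exact ⟨by linarith [ht.1], by linarith [ht.2]⟩
    have hid := hH.integral_fderiv_mul_inner_eq _ hφ v w
    -- left-hand side `= I`
    have hL : (∫ t, ∫ x, fderiv ℝ (fun x => χ t * ψ x) x v * ⟪(fun _ : ℝ => U) t x, w⟫) = I := by
      have h1 : ∀ t, (∫ x, fderiv ℝ (fun x => χ t * ψ x) x v * ⟪(fun _ : ℝ => U) t x, w⟫) =
          χ t * I := by
        intro t
        have h2 : ∀ x, fderiv ℝ (fun x => χ t * ψ x) x v = χ t * fderiv ℝ ψ x v := by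
          intro x
          have hd : DifferentiableAt ℝ ψ x :=
            (hψ.contDiff.differentiable (by simp)).differentiableAt
          rw [fderiv_const_mul hd]
          rfl
        simp_rw [h2, mul_assoc]
        exact integral_const_mul _ _
      simp_rw [h1]
      rw [integral_mul_const, hχ_int, one_mul]
    rw [hL] at hid
    -- right-hand side: pointwise bound by the indicator of `S = (−a², 0) × B_R`
    set S : Set (ℝ × EuclideanSpace ℝ (Fin 3)) :=
      Ioo (-(a ^ 2)) 0 ×ˢ ball (0 : EuclideanSpace ℝ (Fin 3)) R with hS
    have hSm : MeasurableSet S := measurableSet_Ioo.prod measurableSet_ball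
    have hSsub : S ⊆ Iio (0 : ℝ) ×ˢ (univ : Set (EuclideanSpace ℝ (Fin 3))) :=
      prod_mono (fun t ht => ht.2) (subset_univ _)
    set C : ℝ≥0∞ := ENNReal.ofReal (2 / a ^ 2 * M * ‖v‖ * ‖w‖) with hC
    have hpt : ∀ t x, ‖χ t * ψ x * ⟪H t x v, w⟫‖ₑ ≤
        C * S.indicator (fun q => ‖H q.1 q.2‖ₑ) (t, x) := by
      intro t x
      by_cases hχt : χ t = 0
      · simp [hχt]
      by_cases hψx : ψ x = 0
      · simp [hψx]
      have hmem : (t, x) ∈ S :=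
        ⟨hχ_supp t hχt, hR (subset_tsupport _ (Function.mem_support.2 hψx))⟩
      rw [indicator_of_mem hmem, hC, ← ofReal_norm, ← ofReal_norm (H t x),
        ← ENNReal.ofReal_mul (by positivity)]
      refine ENNReal.ofReal_le_ofReal ?_
      rw [norm_mul, norm_mul, Real.norm_eq_abs, abs_of_nonneg (hχ_nonneg t)]
      have h1 : ‖⟪H t x v, w⟫‖ ≤ ‖H t x‖ * ‖v‖ * ‖w‖ :=
        (norm_inner_le_norm _ _).trans (by gcongr; exact (H t x).le_opNorm v)
      have e1 : χ t * ‖ψ x‖ ≤ 2 / a ^ 2 * M :=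
        mul_le_mul (hχ_le t) (hM x) (norm_nonneg _) (by positivity)
      calc χ t * ‖ψ x‖ * ‖⟪H t x v, w⟫‖
          ≤ (2 / a ^ 2 * M) * (‖H t x‖ * ‖v‖ * ‖w‖) :=
            mul_le_mul e1 h1 (norm_nonneg _) (by positivity)
        _ = 2 / a ^ 2 * M * ‖v‖ * ‖w‖ * ‖H t x‖ := by ring
    have hmeasS : AEMeasurable (S.indicator fun q : ℝ × EuclideanSpace ℝ (Fin 3) => ‖H q.1 q.2‖ₑ)
        ((volume : Measure ℝ).prod (volume : Measure (EuclideanSpace ℝ (Fin 3)))) := by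
      rw [← Measure.volume_eq_prod, aemeasurable_indicator_iff hSm]
      exact (hHmeas.mono_measure (Measure.restrict_mono hSsub le_rfl)).enorm
    have hbound : ‖I‖ₑ ≤ C * (ENNReal.ofReal ε * ENNReal.ofReal (a ^ 2)) := by
      calc ‖I‖ₑ = ‖∫ t, ∫ x, χ t * ψ x * ⟪H t x v, w⟫‖ₑ := by
            rw [hid, enorm_neg]
        _ ≤ ∫⁻ t, ‖∫ x, χ t * ψ x * ⟪H t x v, w⟫‖ₑ := enorm_integral_le_lintegral_enorm _
        _ ≤ ∫⁻ t, ∫⁻ x, ‖χ t * ψ x * ⟪H t x v, w⟫‖ₑ :=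
            lintegral_mono fun t => enorm_integral_le_lintegral_enorm _
        _ ≤ ∫⁻ t, ∫⁻ x, C * S.indicator (fun q => ‖H q.1 q.2‖ₑ) (t, x) :=
            lintegral_mono fun t => lintegral_mono fun x => hpt t x
        _ = C * ∫⁻ t, ∫⁻ x, S.indicator (fun q => ‖H q.1 q.2‖ₑ) (t, x) := by
            rw [← lintegral_const_mul' _ _ ENNReal.ofReal_ne_top]
            congr 1 with t
            rw [lintegral_const_mul' _ _ ENNReal.ofReal_ne_top]
        _ = C * ∫⁻ q in S, ‖H q.1 q.2‖ₑ := by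
            rw [← lintegral_indicator hSm, Measure.volume_eq_prod, lintegral_prod _ hmeasS]
        _ ≤ C * (ENNReal.ofReal ε * ENNReal.ofReal (a ^ 2)) := by gcongr
    have hfin : C * (ENNReal.ofReal ε * ENNReal.ofReal (a ^ 2)) = ENNReal.ofReal (K * ε) := by
      rw [hC, ← ENNReal.ofReal_mul hε.le, ← ENNReal.ofReal_mul (by positivity)]
      congr 1
      rw [hK]
      field_simp
    rw [hfin, ← ofReal_norm, Real.norm_eq_abs] at hbound
    exact (ENNReal.ofReal_le_ofReal_iff (by positivity)).1 hbound
  -- conclusion: `|I| ≤ K ε` for all `ε > 0` forces `I = 0`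
  have hle : |I| ≤ 0 := by
    refine le_of_forall_pos_le_add fun ε hε => ?_
    have := key (ε / (K + 1)) (by positivity)
    calc |I| ≤ K * (ε / (K + 1)) := this
      _ ≤ 0 + ε := by
          rw [zero_add, mul_div_assoc']
          rw [div_le_iff₀ (by positivity)]
          nlinarith
  exact abs_nonpos_iff.1 hle

/-- **A steady member has zero spatial weak derivative.**  Under the hypotheses of
`integral_fderiv_mul_inner_eq_zero_of_steady`, `U` has the weak derivative `0` on all of `ℝ³`
in the sense of the tree's `Literature.Analysis.FunctionSpaces.HasWeakFDerivOn`. [folklore] -/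
theorem hasWeakFDerivOn_zero_of_steady
    {U : EuclideanSpace ℝ (Fin 3) → EuclideanSpace ℝ (Fin 3)}
    {H : ℝ → EuclideanSpace ℝ (Fin 3) → EuclideanSpace ℝ (Fin 3) →L[ℝ] EuclideanSpace ℝ (Fin 3)}
    (hH : HasWeakSpatialGradientOn (slab (EuclideanSpace ℝ (Fin 3)) (Iio 0) isOpen_Iio)
      (fun _ : ℝ => U) H)
    (hsmall : ∀ R : ℝ, 0 < R → ∀ ε : ℝ, 0 < ε → ∃ a : ℝ, R < a ∧
      ∫⁻ q in Ioo (-(a ^ 2)) 0 ×ˢ ball (0 : EuclideanSpace ℝ (Fin 3)) R, ‖H q.1 q.2‖ₑ ≤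
        ENNReal.ofReal ε * ENNReal.ofReal (a ^ 2)) :
    HasWeakFDerivOn (⊤ : Opens (EuclideanSpace ℝ (Fin 3))) volume U 0 where
  locallyIntegrableOn := by
    rw [Opens.coe_top, locallyIntegrableOn_univ]
    exact locallyIntegrable_of_steady hH.locallyIntegrableOn
  locallyIntegrableOn_deriv :=
    (locallyIntegrable_const (0 : EuclideanSpace ℝ (Fin 3) →L[ℝ] EuclideanSpace ℝ (Fin 3))
      ).locallyIntegrableOn _
  integral_fderiv_smul_eq φ v hφ := by
    simp only [Opens.coe_top, Measure.restrict_univ, Pi.zero_apply,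
      _root_.zero_apply, smul_zero, integral_zero, neg_zero]
    have hint : Integrable (fun x => fderiv ℝ φ x v • U x) volume :=
      (locallyIntegrable_of_steady hH.locallyIntegrableOn).integrable_smul_left_of_hasCompactSupport
        ((hφ.contDiff.continuous_fderiv (by simp)).clm_apply continuous_const)
        (hφ.hasCompactSupport.fderiv_apply (𝕜 := ℝ) v)
    refine integral_eq_zero_of_forall_integral_inner_eq_zero (𝕜 := ℝ) _ hint fun c => ?_
    have h1 : ∀ x, ⟪c, fderiv ℝ φ x v • U x⟫ = fderiv ℝ φ x v * ⟪U x, c⟫ := fun x => by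
      rw [real_inner_smul_right, real_inner_comm]
    simp_rw [h1]
    exact integral_fderiv_mul_inner_eq_zero_of_steady hH hsmall hφ v c

end Steady

end Summit.NavierStokesRegularity.NavierStokesRegularity.Theorems.PowerGaugeEulerLiouville
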